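import Literature.AnabelianGeometry.EtaleTheta.Discharge.Sec3Cor38PerfectionR
import Literature.AnabelianGeometry.EtaleTheta.Discharge.Sec3Cor38iiiHoldsWeak
import Literature.AnabelianGeometry.EtaleTheta.Discharge.Sec3Cor38iiiOfIsFrobenioidWeak
import Literature.AnabelianGeometry.EtaleTheta.Discharge.Sec3BLambdaInjectiveOfGaloisCoveringConnected
import Literature.AnabelianGeometry.EtaleTheta.TemperedFrobenioidOfGaloisCoveringRankOnePointR
import HarnessLib

/-!
# [EtTh] Cor. 3.8, proof row C38-L03′ «`Ψ` is compatible with passing to the perfection» — the repaired reading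
# `Cor38Hyp.CompatibleWithPerfectionR` over the WEAK monoid vocabulary and AT THE GENUINE CARRIERS
# (D-0079 L-F [EtTh] row F-2811; seat abc-iut-w5-d246; PROOF-ONLY, 0 `def`; part C of `Sec3Cor38RowsGenuineCarriersWeak*`)

Mochizuki, *The étale theta function and its Frobenioid-theoretic manifestations*, Publ. RIMS **45** (2009), proof of
Cor. 3.8, PDF p. 81 l. 3–4 [cite: MochizukiEtTh2009, Cor 3.8 p.81]: «Moreover, `Ψ` is compatible with the operation of passing
to the perfection [cf. [Mzk17], Theorem 3.4, (iii)]».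

Row F-2811 `Cor38Hyp.CompatibleWithPerfection` is typed STRONGER than print (a `1`-unique square for an ARBITRARY perfection
datum) and REFUTED as typed (`Sec3Cor38CompatibleWithPerfectionNegative.lean`); the cell's repaired, print-faithful reading is
abc-iut-w5-d124's `Cor38Hyp.CompatibleWithPerfectionR hF₁ hF₂` (THE perfections of the Frobenioids `C_i`, structure-compatible
`1`-uniqueness; `Sec3Cor38PerfectionR.lean`), PROVED there modulo `hF_i` over the STRONG tree monoid vocabulary only
(`compatibleWithPerfectionR_of_preservesPreSteps`, section `TreeVocab`).  The genuine carriers of the cell (the weak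
constructed Def. 3.3 (iii) data `ofRlfRWeak (ofGaloisActionConnected …)`) live over the WEAK vocabulary `treeMonoidVocabWeak`;
this file supplies the missing weak twin and its instances:

* `compatibleWithPerfectionR_of_isFrobenioid_weak` — over `treeMonoidVocabWeak` (any category vocabularies), modulo `hF₁`,
  `hF₂` ONLY: the vocabulary-generic `compatibleWithPerfectionR_of_isFrobeniusCompatible` (section `General` of
  `Sec3Cor38PerfectionR.lean`) fed with abc-iut-L2-d2's weak `isFrobeniusCompatible_of_preservesPreSteps_weak` and
  `preservesPreSteps_of_isFrobenioid_weak`;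
* at the GENUINE BASE `B^temp(Π)⁰` for EVERY pair of tempered Frobenioids of monoid type `ℝ` over the weak connected data
  (NO Prop binder; the `hF_i` ARGUMENTS of the statement are the theorems of abc-iut-w6-d048's lineage), at bases of FSM-type
  (modulo `IsOfFSMType D_i`), and at the monoid-type-`ℝ` model of record `TateTowerFrd.temperedFrobenioidR` (NO binder).

Honest framing: refereed pre-IUT material; «PROVED» = OUR kernel check of OUR typed (repaired) instance form; the row's ORIGINAL
decl stays refuted as typed; constructed data = the cell's models of Def. 3.3/3.6, not an étale theta function of a curve; nothing
here bears on, or takes a side on, [IUTchIII] Cor. 3.12.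
-/

noncomputable section

namespace Literature.AnabelianGeometry.EtaleTheta

open CategoryTheory Opposite Literature.AlgebraicGeometry.Frobenioids Literature.AnabelianGeometry.SemiGraphs
  LogDivisorModel.GaloisAction

universe u₀ v₀ u v w u' v' uG

namespace Cor38Hyp

/-! ## §0. The weak-vocabulary twin of `compatibleWithPerfectionR_of_preservesPreSteps` -/

section Weak

variable {D₀ : Type u₀} [Category.{v₀} D₀] {D₀' : Type u₀} [Category.{v₀} D₀']
  {T : RealifiedDivisorMonoids (D₀ := D₀) treeMonoidVocabWeak.{w}}
  {T' : RealifiedDivisorMonoids (D₀ := D₀') treeMonoidVocabWeak.{w}}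
  {D : Type u} [Category.{v} D] {D' : Type u} [Category.{v} D']
  {VD : FrdICatStub.{u, v, w} D} {VD' : FrdICatStub.{u, v, w} D'}
  {C₁ : TemperedFrobenioid T D VD} {C₂ : TemperedFrobenioid T' D' VD'} (h : Cor38Hyp C₁ C₂)

/-- **C38-L03′ over the WEAK monoid vocabulary, modulo `hF₁`, `hF₂` only**: `Ψ` is compatible with passing to THE
perfections — the `1`-commutative, structure-compatibly `1`-unique square `Ψ^pf ∘ (C₁ → C₁^pf) ≅ (C₂ → C₂^pf) ∘ Ψ` with
`Ψ^pf` an equivalence ([FrdI] Thm. 3.4 (iii)); from pre-step preservation (C38-L02a, `preservesPreSteps_of_isFrobenioid_weak`)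
via Frobenius-compatibility (`isFrobeniusCompatible_of_preservesPreSteps_weak`). [cite: MochizukiEtTh2009, Cor 3.8 p.81] -/
theorem compatibleWithPerfectionR_of_isFrobenioid_weak (hF₁ : PreFrobenioid.IsFrobenioid C₁.toElem)
    (hF₂ : PreFrobenioid.IsFrobenioid C₂.toElem) :
    Literature.AnabelianGeometry.EtaleTheta.Cor38Hyp.CompatibleWithPerfectionR h hF₁ hF₂ :=
  h.compatibleWithPerfectionR_of_isFrobeniusCompatible hF₁ hF₂
    (h.isFrobeniusCompatible_of_preservesPreSteps_weak hF₁ hF₂ (h.preservesPreSteps_of_isFrobenioid_weak hF₁ hF₂))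

end Weak

/-! ## §1. The genuine base `B^temp(Π)⁰`, monoid type `ℝ`, weak constructed data — no Prop binder -/

section GenuineBase

variable {Z : LogDivisorModel.{u}} {G : Type u} [Group G] {A : Z.GaloisAction G} {hZ : Z.CuspLaws}
  {hpf : ∀ Y : ((isConnectedGSet (G := G)).FullSubcategory)ᵒᵖ,
    IsPerfFactorialCof ((DivisorMonoids.ofGaloisActionConnected A hZ).Φ₀.obj Y)}
  {Z' : LogDivisorModel.{u}} {G' : Type u} [Group G'] {A' : Z'.GaloisAction G'} {hZ' : Z'.CuspLaws}
  {hpf' : ∀ Y : ((isConnectedGSet (G := G')).FullSubcategory)ᵒᵖ,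
    IsPerfFactorialCof ((DivisorMonoids.ofGaloisActionConnected A' hZ').Φ₀.obj Y)}
  {P : Type uG} [Group P] [TopologicalSpace P] {P' : Type uG} [Group P'] [TopologicalSpace P']
  {IsRational IsStrictlyRational : ((ConnectedPart (BTemp P))ᵒᵖ ⥤ CommMonCat.{u}) → Prop}
  {IsRational' IsStrictlyRational' : ((ConnectedPart (BTemp P'))ᵒᵖ ⥤ CommMonCat.{u}) → Prop}
  {C₁ : TemperedFrobenioid (RealifiedDivisorMonoids.ofRlfRWeak (DivisorMonoids.ofGaloisActionConnected A hZ) hpf)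
    (ConnectedPart (BTemp P)) (treeCatVocab (ConnectedPart (BTemp P)) IsRational IsStrictlyRational)}
  {C₂ : TemperedFrobenioid (RealifiedDivisorMonoids.ofRlfRWeak (DivisorMonoids.ofGaloisActionConnected A' hZ') hpf')
    (ConnectedPart (BTemp P')) (treeCatVocab (ConnectedPart (BTemp P')) IsRational' IsStrictlyRational')}
  (h : Cor38Hyp C₁ C₂)

/-- **C38-L03′ (repaired F-2811) at the genuine base `B^temp(Π)⁰`, NO Prop binder**: for every Cor. 3.8 datum between
tempered Frobenioids of monoid type `ℝ` over the weak connected data, `Ψ` is compatible with passing to THE perfections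
(the `hF_i` arguments are abc-iut-w6-d048's theorems `isFrobenioid_ofRlfRWeak_ofGaloisActionConnected_connectedPart_bTemp`).
[cite: MochizukiEtTh2009, Cor 3.8 p.81] -/
theorem compatibleWithPerfectionR_ofRlfRWeak_connectedPart_bTemp :
    Literature.AnabelianGeometry.EtaleTheta.Cor38Hyp.CompatibleWithPerfectionR h
      (TemperedFrobenioid.isFrobenioid_ofRlfRWeak_ofGaloisActionConnected_connectedPart_bTemp A hZ hpf C₁)
      (TemperedFrobenioid.isFrobenioid_ofRlfRWeak_ofGaloisActionConnected_connectedPart_bTemp A' hZ' hpf' C₂) :=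
  h.compatibleWithPerfectionR_of_isFrobenioid_weak _ _

end GenuineBase

/-! ## §2. Bases of FSM-type — modulo `IsOfFSMType D_i` only -/

section FSMBase

variable {Z : LogDivisorModel.{u}} {G : Type u} [Group G] {A : Z.GaloisAction G} {hZ : Z.CuspLaws}
  {hpf : ∀ Y : ((isConnectedGSet (G := G)).FullSubcategory)ᵒᵖ,
    IsPerfFactorialCof ((DivisorMonoids.ofGaloisActionConnected A hZ).Φ₀.obj Y)}
  {Z' : LogDivisorModel.{u}} {G' : Type u} [Group G'] {A' : Z'.GaloisAction G'} {hZ' : Z'.CuspLaws}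
  {hpf' : ∀ Y : ((isConnectedGSet (G := G')).FullSubcategory)ᵒᵖ,
    IsPerfFactorialCof ((DivisorMonoids.ofGaloisActionConnected A' hZ').Φ₀.obj Y)}
  {D : Type u'} [Category.{v'} D] {D' : Type u'} [Category.{v'} D']
  {IsRational IsStrictlyRational : (Dᵒᵖ ⥤ CommMonCat.{u}) → Prop}
  {IsRational' IsStrictlyRational' : (D'ᵒᵖ ⥤ CommMonCat.{u}) → Prop}
  {C₁ : TemperedFrobenioid (RealifiedDivisorMonoids.ofRlfRWeak (DivisorMonoids.ofGaloisActionConnected A hZ) hpf) D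
    (treeCatVocab D IsRational IsStrictlyRational)}
  {C₂ : TemperedFrobenioid (RealifiedDivisorMonoids.ofRlfRWeak (DivisorMonoids.ofGaloisActionConnected A' hZ') hpf') D'
    (treeCatVocab D' IsRational' IsStrictlyRational')}
  (h : Cor38Hyp C₁ C₂) (hD : IsOfFSMType D) (hD' : IsOfFSMType D')

/-- **C38-L03′ (repaired F-2811) over bases of FSM-type**, modulo `IsOfFSMType D_i` only.
[cite: MochizukiEtTh2009, Cor 3.8 p.81] -/
theorem compatibleWithPerfectionR_ofRlfRWeak_of_isOfFSMType :
    Literature.AnabelianGeometry.EtaleTheta.Cor38Hyp.CompatibleWithPerfectionR h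
      (TemperedFrobenioid.isFrobenioid_ofRlfRWeak_ofGaloisActionConnected_of_isOfFSMType A hZ hpf C₁ hD)
      (TemperedFrobenioid.isFrobenioid_ofRlfRWeak_ofGaloisActionConnected_of_isOfFSMType A' hZ' hpf' C₂ hD') :=
  h.compatibleWithPerfectionR_of_isFrobenioid_weak _ _

end FSMBase

/-! ## §3. The model of record, monoid type `ℝ` — no binder -/

section TateTower

variable (R S R' S' : ((Discrete PUnit.{1})ᵒᵖ ⥤ CommMonCat.{0}) → Prop)
  (h : Cor38Hyp (TateTowerFrd.temperedFrobenioidR R S) (TateTowerFrd.temperedFrobenioidR R' S'))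

/-- **C38-L03′ (repaired F-2811) at the Tate tower (`Λ = ℝ`), NO binder.** [cite: MochizukiEtTh2009, Cor 3.8 p.81] -/
theorem compatibleWithPerfectionR_tateTowerR :
    Literature.AnabelianGeometry.EtaleTheta.Cor38Hyp.CompatibleWithPerfectionR h
      (TateTowerFrd.isFrobenioid_temperedFrobenioidR_byName R S)
      (TateTowerFrd.isFrobenioid_temperedFrobenioidR_byName R' S') :=
  h.compatibleWithPerfectionR_of_isFrobenioid_weak _ _

end TateTower

end Cor38Hyp

end Literature.AnabelianGeometry.EtaleTheta

end
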